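import Summits.KontsevichZagierPeriods.KontsevichZagierPeriods.Theses.WZCosetWall

/-!
# `SummationClosure` (stmt-KontsevichZagierPeriods-6876, route WZCosetWall, rank 5) — birth skeleton

Crux (Σ of the thesis): the four-move relation group `KZ.relations` is closed under DOMINATED RATIONAL-GEOMETRIC
TERMWISE SUMMATION. Data: two families `r m = [σ, Σ_{j<d} f_j·C(m+j,j)·q^m]`, `s m = [τ, Σ_{j<d'} g_j·C(m+j,j)·q'^m]`
with `|q|, |q'| < 1` on the domains, their resummations `rs = [σ, Σ_j f_j/(1−q)^{j+1}]`, `ss = [τ, Σ_j g_j/(1−q')^{j+1}]`,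
and the dominating functions `Σ_j |f_j|/(1−|q|)^{j+1}`, `Σ_j |g_j|/(1−|q'|)^{j+1}` integrable on `σ`, `τ`. Claim: if
`[r m] − [s m] ∈ KZ.relations` for every `m`, then `[rs] − [ss] ∈ KZ.relations`.

Line `birth` = the SOUNDNESS ∕ KERNEL cut that the route review recorded for this crux (refuter g42-11 and grounder
g16-10 on the item: "the Σ-rule is sound by dominated convergence; the conclusion is then an instance of the kernel
conjecture on the resummed pair"), turned into two named obligations of different nature:

* `stub_hasSum_value` — ANALYSIS, no KZ content (provable now, size M). For ONE family of the above shape the values are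
  summable to the value of the resummation: `HasSum (m ↦ value (r m)) (value rs)`. Pointwise on the domain
  `Σ_m C(m+j,j) q^m = (1−q)^{−(j+1)}` (`hasSum_choose_mul_geometric_of_norm_lt_one`), so `Σ_m (r m).integrand x =
  rs.integrand x`; the bound `m x ↦ Σ_j |f_j x|·C(m+j,j)·|q x|^m` has `tsum` equal to the dominating function, which is the
  `IntegrableOn` hypothesis; conclude with `MeasureTheory.hasSum_integral_of_dominated_convergence` on `volume.restrict σ`
  (each `(r m).integrand` is integrable on `σ = (r m).domain` by the structure field `integrableOn`). Why it might fail: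
  only a mis-typing (it is dominated convergence); the absolute convergence `Σ_m |value (r m)| ≤ ∫ dominating function`
  is what makes the unconditional `HasSum` (not just ordered partial sums) correct.
* `stub_resummedSectorKernel` — TRANSCENDENCE, the honest open part (conjecture-grade). CONJECTURE 1 ON THE RESUMMED
  SECTOR: two resummed representations of the above shape whose geometric expansions are TERMWISE equivalent in the
  calculus and whose VALUES AGREE are equivalent. It is the crux with its two domination hypotheses REPLACED by the value
  identity they imply (so neither statement is a rewording of the other: crux = stub₂ ∘ stub₁); implied by
  `KZKernelConjecture` (kernel form of the summit) and by nothing weaker on file. The route's engine (support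
  `ResummedPrimitiveNL`: a family of Newton–Leibniz moves with primitives `P·C(m+j,j)·q^m` resums to ONE move with the
  algebraic primitive `P/(1−q)^{j+1}`) proves every instance carrying a UNIFORM certificate (first compiled instance: crux
  `BauerHalfShift`; warm-up: support `ZetaTwoOddEven`); the stub is exactly where a NON-uniformly certified family would
  have to be handled. Why it might fail: as the crux — a termwise-accessible family with inaccessible resummation refutes
  it and the summit together.

Composition (sorry-free): `summationClosure_of_stubs : <stub₁-sig> → <stub₂-sig> → <crux, unfolded verbatim>` — soundness
of the calculus (`KZ.relations_le_ker_eval_holds`) turns each termwise relation into `value (r m) = value (s m)`;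
`stub_hasSum_value` on both families and `HasSum.unique` give `value rs = value ss`; `stub_resummedSectorKernel` concludes.
`SummationClosure_of : SummationClosure` feeds the two stubs in BY NAME (the theorem the skeleton audit keys on; `sorry`
enters only through the two named stubs). Disproof used: none on file (`ledger crux ls stmt-KontsevichZagierPeriods-6876`:
no `Disproof.lean`, no lines, no ideas; `ledger negatives --problem KontsevichZagierPeriods`: no summation-closure
statement). Sources: KontsevichZagier2001 §1.2 (rules, Conjecture 1; p. 9 the termwise ζ(2) step),
PetkovsekWilfZeilberger1996, WilfZeilberger1992 (certificates), HuberMullerStach2017 §13.1.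
-/

set_option linter.dupNamespace false

noncomputable section

namespace Summit.KontsevichZagierPeriods.KontsevichZagierPeriods.Cruxes.SummationClosure.Birth

open Summit.KontsevichZagierPeriods.KontsevichZagierPeriods.Theses.WZCosetWall (SummationClosure)

/-! ## The two stubs -/

/-- Stub 1 — TERMWISE SUMMATION OF VALUES (dominated convergence; analysis only). For one rational-geometric family
`r m = [σ, Σ_{j<d} f_j·C(m+j,j)·q^m]` with `|q| < 1` on `σ`, resummation `rs = [σ, Σ_j f_j/(1−q)^{j+1}]` and the
dominating function `Σ_j |f_j|/(1−|q|)^{j+1}` integrable on `σ`, the series of values converges (absolutely) to the value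
of the resummation. Leans on: `hasSum_choose_mul_geometric_of_norm_lt_one`,
`MeasureTheory.hasSum_integral_of_dominated_convergence`, `KZ.IntegralRep.integrableOn`,
`KZ.IntegralRep.measurableSet_domain_holds`. Size M, provable now. [cite: KontsevichZagier2001, §1.2] -/
theorem stub_hasSum_value : ∀ (n d : ℕ) (q : (Fin n → ℝ) → ℝ) (f : Fin d → (Fin n → ℝ) → ℝ) (r : ℕ → Literature.NumberTheory.Transcendental.KZ.IntegralRep n) (rs : Literature.NumberTheory.Transcendental.KZ.IntegralRep n), (∀ m, (r m).domain = rs.domain) → (∀ x ∈ rs.domain, |q x| < 1) → (∀ m, ∀ x ∈ rs.domain, (r m).integrand x = ∑ j : Fin d, f j x * ((m + (j : ℕ)).choose j : ℝ) * q x ^ m) → (∀ x ∈ rs.domain, rs.integrand x = ∑ j : Fin d, f j x / (1 - q x) ^ ((j : ℕ) + 1)) → MeasureTheory.IntegrableOn (fun x => ∑ j : Fin d, |f j x| / (1 - |q x|) ^ ((j : ℕ) + 1)) rs.domain → HasSum (fun m => (r m).value) rs.value := by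
  sorry

/-- Stub 2 — CONJECTURE 1 ON THE RESUMMED SECTOR (the open part). Two resummed representations
`rs = [σ, Σ_j f_j/(1−q)^{j+1}]`, `ss = [τ, Σ_j g_j/(1−q')^{j+1}]` (`|q|, |q'| < 1`) whose geometric expansions
`[σ, Σ_j f_j·C(m+j,j)·q^m]`, `[τ, Σ_j g_j·C(m+j,j)·q'^m]` are termwise equivalent (`[r m] − [s m] ∈ KZ.relations` for all
`m`) and whose values agree (`rs.value = ss.value`) are equivalent: `[rs] − [ss] ∈ KZ.relations`. The crux with the
domination hypotheses replaced by the value identity; implied by `KZKernelConjecture`; proved by the route's engine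
(`ResummedPrimitiveNL`) whenever the termwise relations carry a uniform certificate. Conjecture-grade.
[cite: KontsevichZagier2001, §1.2 Conjecture 1] -/
theorem stub_resummedSectorKernel : ∀ (n n' d d' : ℕ) (q : (Fin n → ℝ) → ℝ) (q' : (Fin n' → ℝ) → ℝ) (f : Fin d → (Fin n → ℝ) → ℝ) (g : Fin d' → (Fin n' → ℝ) → ℝ) (r : ℕ → Literature.NumberTheory.Transcendental.KZ.IntegralRep n) (s : ℕ → Literature.NumberTheory.Transcendental.KZ.IntegralRep n') (rs : Literature.NumberTheory.Transcendental.KZ.IntegralRep n) (ss : Literature.NumberTheory.Transcendental.KZ.IntegralRep n'), (∀ m, (r m).domain = rs.domain) → (∀ m, (s m).domain = ss.domain) → (∀ x ∈ rs.domain, |q x| < 1) → (∀ y ∈ ss.domain, |q' y| < 1) → (∀ m, ∀ x ∈ rs.domain, (r m).integrand x = ∑ j : Fin d, f j x * ((m + (j : ℕ)).choose j : ℝ) * q x ^ m) → (∀ m, ∀ y ∈ ss.domain, (s m).integrand y = ∑ j : Fin d', g j y * ((m + (j : ℕ)).choose j : ℝ) * q' y ^ m) → (∀ x ∈ rs.domain,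 rs.integrand x = ∑ j : Fin d, f j x / (1 - q x) ^ ((j : ℕ) + 1)) → (∀ y ∈ ss.domain, ss.integrand y = ∑ j : Fin d', g j y / (1 - q' y) ^ ((j : ℕ) + 1)) → (∀ m, Literature.NumberTheory.Transcendental.KZ.of (r m) - Literature.NumberTheory.Transcendental.KZ.of (s m) ∈ Literature.NumberTheory.Transcendental.KZ.relations) → rs.value = ss.value → Literature.NumberTheory.Transcendental.KZ.of rs - Literature.NumberTheory.Transcendental.KZ.of ss ∈ Literature.NumberTheory.Transcendental.KZ.relations := by
  sorry

/-! ## Glue (sorry-free) -/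

open Literature.NumberTheory.Transcendental

/-- Soundness of the calculus on one termwise relation: `[r] − [s] ∈ KZ.relations ⇒ value r = value s`
(`KZ.relations_le_ker_eval_holds`). [cite: KontsevichZagier2001, §1.2] -/
theorem value_eq_of_sub_mem_relations {n n' : ℕ} (r : KZ.IntegralRep n) (s : KZ.IntegralRep n')
    (h : KZ.of r - KZ.of s ∈ KZ.relations) : r.value = s.value := by
  have := KZ.relations_le_ker_eval_holds h
  rwa [AddMonoidHom.mem_ker, map_sub, KZ.eval_of, KZ.eval_of, sub_eq_zero] at this

/-- The composition, arrow form: TERMWISE SUMMATION OF VALUES → RESUMMED-SECTOR KERNEL → the crux (UNFOLDED verbatim, so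
that exactly one theorem of this file, `SummationClosure_of`, concludes the crux by name). Termwise relations give
termwise equal values (soundness), the two value series have the resummed values as sums (stub 1 twice), sums are unique,
and stub 2 applies. [cite: KontsevichZagier2001, §1.2] -/
theorem summationClosure_of_stubs
    (hsum : ∀ (n d : ℕ) (q : (Fin n → ℝ) → ℝ) (f : Fin d → (Fin n → ℝ) → ℝ) (r : ℕ → Literature.NumberTheory.Transcendental.KZ.IntegralRep n) (rs : Literature.NumberTheory.Transcendental.KZ.IntegralRep n), (∀ m, (r m).domain = rs.domain) → (∀ x ∈ rs.domain, |q x| < 1) → (∀ m, ∀ x ∈ rs.domain, (r m).integrand x = ∑ j : Fin d, f j x * ((m + (j : ℕ)).choose j : ℝ) * q x ^ m) → (∀ x ∈ rs.domain, rs.integrand x = ∑ j : Fin d, f j x / (1 - q x) ^ ((j : ℕ) + 1)) → MeasureTheory.IntegrableOn (fun x => ∑ j : Fin d, |f j x| / (1 - |q x|) ^ ((j : ℕ) + 1)) rs.domain → HasSum (fun m => (r m).value) rs.value)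
    (hker : ∀ (n n' d d' : ℕ) (q : (Fin n → ℝ) → ℝ) (q' : (Fin n' → ℝ) → ℝ) (f : Fin d → (Fin n → ℝ) → ℝ) (g : Fin d' → (Fin n' → ℝ) → ℝ) (r : ℕ → Literature.NumberTheory.Transcendental.KZ.IntegralRep n) (s : ℕ → Literature.NumberTheory.Transcendental.KZ.IntegralRep n') (rs : Literature.NumberTheory.Transcendental.KZ.IntegralRep n) (ss : Literature.NumberTheory.Transcendental.KZ.IntegralRep n'), (∀ m, (r m).domain = rs.domain) → (∀ m, (s m).domain = ss.domain) → (∀ x ∈ rs.domain, |q x| < 1) → (∀ y ∈ ss.domain, |q' y| < 1) → (∀ m, ∀ x ∈ rs.domain, (r m).integrand x = ∑ j : Fin d, f j x * ((m + (j : ℕ)).choose j : ℝ) * q x ^ m) → (∀ m, ∀ y ∈ ss.domain, (s m).integrand y = ∑ j : Fin d', g j y * ((m + (j : ℕ)).choose j : ℝ) * q' y ^ m) → (∀ x ∈ rs.domain, rs.integrand x = ∑ j : Fin d, f j x / (1 - q x) ^ ((j : ℕ) + 1)) → (∀ y ∈ ss.domain, ss.integrand y = ∑ j : Fin d', g j y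 / (1 - q' y) ^ ((j : ℕ) + 1)) → (∀ m, Literature.NumberTheory.Transcendental.KZ.of (r m) - Literature.NumberTheory.Transcendental.KZ.of (s m) ∈ Literature.NumberTheory.Transcendental.KZ.relations) → rs.value = ss.value → Literature.NumberTheory.Transcendental.KZ.of rs - Literature.NumberTheory.Transcendental.KZ.of ss ∈ Literature.NumberTheory.Transcendental.KZ.relations) :
    ∀ (n n' d d' : ℕ) (q : (Fin n → ℝ) → ℝ) (q' : (Fin n' → ℝ) → ℝ) (f : Fin d → (Fin n → ℝ) → ℝ) (g : Fin d' → (Fin n' → ℝ) → ℝ) (r : ℕ → Literature.NumberTheory.Transcendental.KZ.IntegralRep n) (s : ℕ → Literature.NumberTheory.Transcendental.KZ.IntegralRep n') (rs : Literature.NumberTheory.Transcendental.KZ.IntegralRep n) (ss : Literature.NumberTheory.Transcendental.KZ.IntegralRep n'), (∀ m, (r m).domain = rs.domain) → (∀ m, (s m).domain = ss.domain) → (∀ x ∈ rs.domain, |q x| < 1) → (∀ y ∈ ss.domain, |q' y| < 1) → (∀ m, ∀ x ∈ rs.domain, (r m).integrand x = ∑ j : Fin d, f j x * ((m + (j : ℕ)).choose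 j : ℝ) * q x ^ m) → (∀ m, ∀ y ∈ ss.domain, (s m).integrand y = ∑ j : Fin d', g j y * ((m + (j : ℕ)).choose j : ℝ) * q' y ^ m) → (∀ x ∈ rs.domain, rs.integrand x = ∑ j : Fin d, f j x / (1 - q x) ^ ((j : ℕ) + 1)) → (∀ y ∈ ss.domain, ss.integrand y = ∑ j : Fin d', g j y / (1 - q' y) ^ ((j : ℕ) + 1)) → MeasureTheory.IntegrableOn (fun x => ∑ j : Fin d, |f j x| / (1 - |q x|) ^ ((j : ℕ) + 1)) rs.domain → MeasureTheory.IntegrableOn (fun y => ∑ j : Fin d', |g j y| / (1 - |q' y|) ^ ((j : ℕ) + 1)) ss.domain → (∀ m, Literature.NumberTheory.Transcendental.KZ.of (r m) - Literature.NumberTheory.Transcendental.KZ.of (s m) ∈ Literature.NumberTheory.Transcendental.KZ.relations) → Literature.NumberTheory.Transcendental.KZ.of rs - Literature.NumberTheory.Transcendental.KZ.of ss ∈ Literature.NumberTheory.Transcendental.KZ.relations := by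
  intro n n' d d' q q' f g r s rs ss hrd hsd hq hq' hri hsi hrsi hssi hIr hIs hrel
  refine hker n n' d d' q q' f g r s rs ss hrd hsd hq hq' hri hsi hrsi hssi hrel ?_
  have h₁ : HasSum (fun m => (r m).value) rs.value := hsum n d q f r rs hrd hq hri hrsi hIr
  have h₂ : HasSum (fun m => (s m).value) ss.value := hsum n' d' q' g s ss hsd hq' hsi hssi hIs
  have h₃ : (fun m => (r m).value) = fun m => (s m).value :=
    funext fun m => value_eq_of_sub_mem_relations (r m) (s m) (hrel m)
  rw [h₃] at h₁
  exact h₁.unique h₂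

/-- **The skeleton theorem** (concludes the crux BY NAME; sorries enter only through the two named stubs):
`SummationClosure` from TERMWISE SUMMATION OF VALUES and the RESUMMED-SECTOR KERNEL statement.
[cite: KontsevichZagier2001, §1.2 Conjecture 1] -/
theorem SummationClosure_of : SummationClosure :=
  summationClosure_of_stubs stub_hasSum_value stub_resummedSectorKernel

end Summit.KontsevichZagierPeriods.KontsevichZagierPeriods.Cruxes.SummationClosure.Birth

end
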